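import Summits.CriticalPhenomena.SAWScalingLimit.Theses.SAWRenewalTightness
import Summits.CriticalPhenomena.SAWScalingLimit.Theorems.SubseqIdentification.Negative.ProbabilityRedundant
import Summits.CriticalPhenomena.SAWScalingLimit.Theorems.SubseqIdentification.Negative.CoincidentEndpointLaw

/-!
# `ConfinementPositivity` (stmt-CriticalPhenomena-17587) — negative knowledge: load-bearing hypotheses

Refuter crux-attack support file for the crux
`Summit.CriticalPhenomena.SAWScalingLimit.Theses.SAWRenewalTightness.ConfinementPositivity`
(restriction positivity for nested socketed Dobrushin domains `D' ⊆ D`: the critical SAW of `D_δ`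
from `a_δ` to `b_δ` is a `D'_δ`-walk with probability `≥ c > 0` for `δ ∈ (0, δ₀]`).  The crux itself
SURVIVES the cheap attacks (it is implied by `SAWScalingLimit` plus hull-avoidance positivity of the
SLE_{8/3} law, `Theorems.confinementPositivity_of_scalingLimit`); recorded here, kernel-checked:

* `diag` — the degenerate instance `D' = D` HOLDS with `c = 1` (consistency of the diagonal);
* `nonVacuous` — the hypotheses are jointly satisfiable (unit disc, honest endpoints);
* `false_without_endpointApprox` — dropping `IsEndpointApprox D' a b` makes the statement FALSE
  (far endpoints outside `Ω_δ`: the law is the junk measure `0` at every mesh);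
* `not_uniformThreshold` — the quantifier swap `∀ D D' d … ∃ c δ₀ ∀ (a, b)` is FALSE (splice the
  honest approximation below `δ₀/2` with far endpoints above; `IsEndpointApprox` only sees the germ
  at `0⁺`), the same moral as `EventualTight.Negative.not_uniformThreshold`: the threshold `δ₀`
  must depend on the approximation.
All statements are written on the VERBATIM body of the crux (weakenings / instances of it); no
positive Theses conclusion is asserted. Everything proved, standard axioms. [folklore]
-/

noncomputable section

namespace Summit.CriticalPhenomena.SAWScalingLimit.Theorems.ConfinementPositivity.Negative

open MeasureTheory Set Metric Filter Topology
open Literature.Probability.RandomPlanarGeometry Literature.Probability.LatticeModels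
open Summit.CriticalPhenomena.SAWScalingLimit.Theorems.SubseqIdentification.Negative

/-- **Non-vacuity.** The hypotheses of the crux are jointly satisfiable: unit disc, `D' = D`, `d = 1`,
the honest endpoint approximation `isEndpointApprox_std`. [folklore] -/
theorem nonVacuous : ∃ (D D' : DobrushinDomain) (a b : ℝ → Site 2) (d : ℝ), 0 < d ∧
    D'.carrier ⊆ D.carrier ∧ D'.pt 0 = D.pt 0 ∧ D'.pt 1 = D.pt 1 ∧
    D.carrier ∩ (Metric.ball (D.pt 0) d ∪ Metric.ball (D.pt 1) d) ⊆ D'.carrier ∧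
    SAW.IsEndpointApprox D' a b :=
  ⟨DobrushinDomain.unitDisc, DobrushinDomain.unitDisc, _, _, 1, one_pos, subset_rfl, rfl, rfl,
    inter_subset_left, isEndpointApprox_std⟩

/-- **Diagonal.** The degenerate instance `D' = D` of the crux HOLDS with `c = 1`: the event is
everything and the law is a probability measure below the reachability threshold
(`eventually_isProbabilityMeasure_law`). [folklore] -/
theorem diag (D : DobrushinDomain) (a b : ℝ → Site 2) (hab : SAW.IsEndpointApprox D a b) :
    ∃ c δ₀ : ℝ, 0 < c ∧ 0 < δ₀ ∧ ∀ δ ∈ Set.Ioc (0 : ℝ) δ₀,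
      ENNReal.ofReal c ≤ SAW.law D.carrier δ (a δ) (b δ)
        {γ | ∃ γ' : SAW.DomainSAW D.carrier δ (a δ) (b δ), γ'.walk.support = γ.walk.support} := by
  obtain ⟨δ₂, hδ₂, h⟩ :=
    (nhdsGT_basis (0 : ℝ)).eventually_iff.1 (eventually_isProbabilityMeasure_law hab)
  refine ⟨1, δ₂ / 2, one_pos, half_pos hδ₂, fun δ hδ => ?_⟩
  haveI hP : IsProbabilityMeasure (SAW.law D.carrier δ (a δ) (b δ)) :=
    h ⟨hδ.1, hδ.2.trans_lt (half_lt_self hδ₂)⟩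
  have huniv : {γ : SAW.DomainSAW D.carrier δ (a δ) (b δ) |
      ∃ γ' : SAW.DomainSAW D.carrier δ (a δ) (b δ), γ'.walk.support = γ.walk.support} = Set.univ :=
    Set.eq_univ_of_forall fun γ => ⟨γ, rfl⟩
  rw [huniv, measure_univ, ENNReal.ofReal_one]

/-- A walk of `Ω_δ` between distinct vertices starts in the discrete domain (its first edge). [folklore] -/
theorem mem_meshDomain_of_walk {Ω : Set ℂ} {δ : ℝ} {x y : Site 2}
    (p : (discreteDomainGraph Ω δ).Walk x y) (hxy : x ≠ y) : x ∈ meshDomain Ω δ := by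
  cases p with
  | nil => exact absurd rfl hxy
  | cons hadj _ => exact (discreteDomainGraph_adj_iff.1 hadj).2.1

/-- No SAW of `Ω_δ` joins a vertex outside the discrete domain to a different vertex. [folklore] -/
theorem isEmpty_domainSAW {Ω : Set ℂ} {δ : ℝ} {u v : Site 2} (hu : u ∉ meshDomain Ω δ)
    (huv : u ≠ v) : IsEmpty (SAW.DomainSAW Ω δ u v) :=
  ⟨fun γ => hu (mem_meshDomain_of_walk γ.walk huv)⟩

/-- … hence the critical SAW law from such a vertex is the junk measure `0`. [folklore] -/
theorem law_eq_zero {Ω : Set ℂ} {δ : ℝ} {u v : Site 2} (hu : u ∉ meshDomain Ω δ) (huv : u ≠ v) :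
    SAW.law Ω δ u v = 0 := by
  haveI := isEmpty_domainSAW hu huv
  exact Measure.eq_zero_of_isEmpty _

/-- The far site `(3⌈δ⁻¹⌉ + k, 0)` is not a vertex of the discretised unit disc `𝔻_δ`, `δ > 0`
(its mesh point has real part `≥ 3`). [folklore] -/
theorem far_not_mem {δ : ℝ} (hδ : 0 < δ) (k : ℕ) :
    (![3 * ⌈δ⁻¹⌉ + k, 0] : Site 2) ∉ meshDomain DobrushinDomain.unitDisc.carrier δ := by
  intro hmem
  have hv := meshDomain_subset_meshVertices _ _ hmem
  rw [mem_meshVertices_iff] at hv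
  change meshPoint δ _ ∈ Metric.ball (0 : ℂ) 1 at hv
  rw [Metric.mem_ball, dist_zero_right] at hv
  have hre : (meshPoint δ ![3 * ⌈δ⁻¹⌉ + k, 0]).re = δ * ((3 * ⌈δ⁻¹⌉ + k : ℤ) : ℝ) := by simp
  have h1 : (3 : ℝ) ≤ δ * ((3 * ⌈δ⁻¹⌉ + k : ℤ) : ℝ) := by
    have hc : δ⁻¹ ≤ (⌈δ⁻¹⌉ : ℝ) := Int.le_ceil _
    have hk : (0 : ℝ) ≤ k := Nat.cast_nonneg k
    push_cast
    have : δ * δ⁻¹ = 1 := mul_inv_cancel₀ hδ.ne'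
    nlinarith
  have h2 : |(meshPoint δ ![3 * ⌈δ⁻¹⌉ + k, 0]).re| ≤ ‖meshPoint δ ![3 * ⌈δ⁻¹⌉ + k, 0]‖ :=
    Complex.abs_re_le_norm _
  rw [hre] at h2
  have h3 : (3 : ℝ) ≤ |δ * ((3 * ⌈δ⁻¹⌉ + k : ℤ) : ℝ)| := h1.trans (le_abs_self _)
  linarith

/-- The two far sites are distinct. [folklore] -/
theorem far_ne (δ : ℝ) : (![3 * ⌈δ⁻¹⌉ + (0 : ℕ), 0] : Site 2) ≠ ![3 * ⌈δ⁻¹⌉ + (1 : ℕ), 0] := by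
  intro h
  have := congrFun h 0
  simp at this

/-- **`IsEndpointApprox` is load-bearing.** The crux WITHOUT the hypothesis `IsEndpointApprox D' a b`
is FALSE: far endpoints outside `Ω_δ` make the law the junk measure `0` at every mesh, so no
`c > 0` works (witness: unit disc, `D' = D`, `a δ = (3⌈δ⁻¹⌉, 0)`, `b δ = (3⌈δ⁻¹⌉ + 1, 0)`). [folklore] -/
theorem false_without_endpointApprox :
    ¬ ∀ (D D' : DobrushinDomain) (a b : ℝ → Site 2) (d : ℝ), 0 < d → D'.carrier ⊆ D.carrier →
      D'.pt 0 = D.pt 0 → D'.pt 1 = D.pt 1 →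
      D.carrier ∩ (Metric.ball (D.pt 0) d ∪ Metric.ball (D.pt 1) d) ⊆ D'.carrier →
      ∃ c δ₀ : ℝ, 0 < c ∧ 0 < δ₀ ∧ ∀ δ ∈ Set.Ioc (0 : ℝ) δ₀,
        ENNReal.ofReal c ≤ SAW.law D.carrier δ (a δ) (b δ)
          {γ | ∃ γ' : SAW.DomainSAW D'.carrier δ (a δ) (b δ), γ'.walk.support = γ.walk.support} := by
  intro h
  obtain ⟨c, δ₀, hc, hδ₀, hall⟩ := h DobrushinDomain.unitDisc DobrushinDomain.unitDisc
    (fun δ => ![3 * ⌈δ⁻¹⌉ + (0 : ℕ), 0]) (fun δ => ![3 * ⌈δ⁻¹⌉ + (1 : ℕ), 0]) 1 one_pos subset_rfl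
    rfl rfl inter_subset_left
  have hmain := hall δ₀ ⟨hδ₀, le_rfl⟩
  rw [law_eq_zero (far_not_mem hδ₀ 0) (far_ne δ₀), Measure.coe_zero, Pi.zero_apply, nonpos_iff_eq_zero,
    ENNReal.ofReal_eq_zero] at hmain
  linarith

/-- **No threshold uniform in the approximation.** The quantifier-swapped strengthening
`∀ D D' d … ∃ c δ₀ ∀ (a, b), IsEndpointApprox D' a b → ∀ δ ∈ (0, δ₀], …` is FALSE: splice the honest
unit-disc approximation below `δ₀/2` with the far endpoints above; the splice is still an honest
`IsEndpointApprox` (`isEndpointApprox_congr`), but at `δ = δ₀` its law is `0`. [folklore] -/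
theorem not_uniformThreshold :
    ¬ ∀ (D D' : DobrushinDomain) (d : ℝ), 0 < d → D'.carrier ⊆ D.carrier →
      D'.pt 0 = D.pt 0 → D'.pt 1 = D.pt 1 →
      D.carrier ∩ (Metric.ball (D.pt 0) d ∪ Metric.ball (D.pt 1) d) ⊆ D'.carrier →
      ∃ c δ₀ : ℝ, 0 < c ∧ 0 < δ₀ ∧ ∀ (a b : ℝ → Site 2), SAW.IsEndpointApprox D' a b →
        ∀ δ ∈ Set.Ioc (0 : ℝ) δ₀,
        ENNReal.ofReal c ≤ SAW.law D.carrier δ (a δ) (b δ)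
          {γ | ∃ γ' : SAW.DomainSAW D'.carrier δ (a δ) (b δ), γ'.walk.support = γ.walk.support} := by
  intro h
  obtain ⟨c, δ₀, hc, hδ₀, hall⟩ := h DobrushinDomain.unitDisc DobrushinDomain.unitDisc 1 one_pos
    subset_rfl rfl rfl inter_subset_left
  set A : ℝ → Site 2 := fun δ => if δ ≤ δ₀ / 2 then ![⌈δ⁻¹⌉ - 1, 0] else ![3 * ⌈δ⁻¹⌉ + (0 : ℕ), 0]
    with hA
  set B : ℝ → Site 2 := fun δ => if δ ≤ δ₀ / 2 then ![-(⌈δ⁻¹⌉ - 1), 0] else ![3 * ⌈δ⁻¹⌉ + (1 : ℕ), 0]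
    with hB
  have hev : ∀ᶠ δ in 𝓝[>] (0 : ℝ), δ ≤ δ₀ / 2 :=
    mem_of_superset (Ioo_mem_nhdsGT (half_pos hδ₀)) fun δ hδ => hδ.2.le
  have hAB : SAW.IsEndpointApprox DobrushinDomain.unitDisc A B :=
    isEndpointApprox_congr isEndpointApprox_std (hev.mono fun δ hδ => by simp [hA, hδ])
      (hev.mono fun δ hδ => by simp [hB, hδ])
  have hmain := hall A B hAB δ₀ ⟨hδ₀, le_rfl⟩
  have hnot : ¬ δ₀ ≤ δ₀ / 2 := not_le.2 (half_lt_self hδ₀)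
  have hAδ : A δ₀ = ![3 * ⌈δ₀⁻¹⌉ + (0 : ℕ), 0] := by simp [hA, hnot]
  have hBδ : B δ₀ = ![3 * ⌈δ₀⁻¹⌉ + (1 : ℕ), 0] := by simp [hB, hnot]
  rw [hAδ, hBδ, law_eq_zero (far_not_mem hδ₀ 0) (far_ne δ₀), Measure.coe_zero, Pi.zero_apply,
    nonpos_iff_eq_zero, ENNReal.ofReal_eq_zero] at hmain
  linarith

end Summit.CriticalPhenomena.SAWScalingLimit.Theorems.ConfinementPositivity.Negative

end
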